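import Mathlib
import Literature.MathematicalPhysics.QuantumFieldTheory.Balaban1983to89.B9SectEKernel

/-! # `Balaban1983to89.B9H163` — B9 p. 429, (3.162)–(3.164): the translation `λ₀ = H′μ` of the Faddeev–Popov step,
kernel-checked ("It is easy to verify that the operator on the right-hand side of (3.163) is equal to the
operator (3.164)")

HONEST FRAMING (cell `lit-balaban`, verbatim): statement-level skeleton of published theorems with citation tags; proofs
where landed; nothing here is a claim about the Yang–Mills mass gap.

CITATION HEADER. Supports the adversarial reading (unit `b2b-balaban-adv1`, gen 10, cell pub-balaban) of
T. Balaban, *Propagators for lattice gauge theories in a background field*, Commun. Math. Phys. 99 (1985) 389–434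
[`Balaban1985BackgroundPropagators`] (= B9), Sect. E p. 429 [PDF 41] (render
`1985-cmp99-background-propagators-p041-x2.png`): *"We make a translation λ = λ′ + λ₀ such that Q′λ − μ = Q′λ′,
i.e. Q′λ₀ = μ, and RΔλ₀ = 0. To find such λ₀ we make use of the last equation. The formula (3.25) for R implies
Δλ₀ − G′Q′*(Q′G′²Q′*)^{−1}(Q′λ₀ − aQ′G′Q′*Q′λ₀) = 0, (3.162) and the condition Q′λ₀ = μ yields
λ₀ = G′²Q′*(Q′G′²Q′*)^{−1}(μ − aQ′G′Q′*μ) + aG′Q′*μ. (3.163) Thus the configuration λ₀ is determined uniquely by the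
two conditions. It is easy to verify that the operator on the right-hand side of (3.163) is equal to the operator
H′μ = (Z′(μ))^{−1}∫dλ δ(Q′λ − μ)e^{−(1/2)‖Δλ‖²}. (3.164)"*, with (3.25) p. 394 [PDF 6]
*"Rf = (I − G′Q′*(Q′G′²Q′*)^{−1}Q′G′)f, where G′ = G′(U) = (Δ′_a)^{−1}"*, Δ′_a = Δ^η_U + Q′*aQ′ (p. 394).
The same step is B6 (CMP 96:223) p. 241 (2.101)–(2.102) (*"It is easy to see that it defines an operator which is
connected with the integral (2.102) in the same way as the operator H_k was connected with the integral (1.47)"*) and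
p. 242 (2.105); B9 cites it as *"Our next step is similar to the one in [4] yielding the formula (2.105) from (2.97)"*.

DICTIONARY (finite index sets, real scalars; the Lie-algebra index is absorbed into `n`): `Δ` = the covariant Laplacian
`Δ^η_U↾Ω₀` (symmetric, invertible), `Q` = `Q′`, `a` = the single Gaussian parameter of (3.24) (B9 takes `a_j` per scale;
a diagonal positive `a` changes nothing below — `a • (Qᵀ * Q)` becomes `Qᵀ * A * Q`; we keep the scalar of the
printed formula), `Δ'` = `Δ′_a`, `G' = Δ'⁻¹`, `G = Δ⁻¹`, `M' = Q′G′²Q′*`, `M = Q′Δ^{−2}Q′*`,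
`R` = (3.25), `H163` = the operator of (3.163), `Hmin = Δ^{−2}Q′*(Q′Δ^{−2}Q′*)^{−1}` = the Lagrange solution of
`min {‖Δλ‖² : Q′λ = μ}` = the operator the Gaussian mean (3.164) computes.

WHAT THIS FILE CERTIFIES (kernel):
1. `Q_mul_H163`, `R_mul_Δ_mul_H163` — (3.163) satisfies the two conditions `Q′λ₀ = μ`, `RΔλ₀ = 0` (the derivation
   (3.162) ⇒ (3.163) read backwards; `Δ_mul_H163` is the clean identity `Δ·H163 = G′Q′*M′^{−1}(1 − aQ′G′Q′*)`).
2. `unique_of_conditions` — the two conditions determine `λ₀` UNIQUELY (the printed "Thus …"): `Q′λ = 0 ∧ RΔλ = 0 ⇒ λ = 0`.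
3. `Q_mul_Hmin`, `R_mul_Δ_mul_Hmin` — the minimiser operator satisfies the same two conditions, through the
   range-transfer identity `range_transfer : Δ^{−1}Q′* = G′Q′*(1 + aQ′Δ^{−1}Q′*)` (this is the whole content of
   "easy to verify": `G′ Ran Q′* = Δ^{−1} Ran Q′*`).
4. `H163_eq_Hmin` — hence the (3.163) operator IS `Hmin`, for every `a` (a-INDEPENDENCE of λ₀).
5. `orth_ker`, `isMinimiser` — `⟨ΔHminμ, Δν⟩ = 0` for `Q′ν = 0`, so `Hminμ` minimises `‖Δλ‖²` on `{Q′λ = μ}`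
   and `‖Δ(Hminμ + ν)‖² = ‖ΔHminμ‖² + ‖Δν‖²`.
6. `integral_smul_even_eq_zero`, `mean_even_eq`, `h164_mean` — the Gaussian-mean step of (3.164): on any
   finite-dimensional real space `E` (= the slice direction `N(Q′)`, embedded by `ι` with `Q′ι = 0`) with a
   neg-invariant measure (every add-Haar measure: `Measure.IsAddHaarMeasure.isNegInvariant_of_regular`), the weight
   `ν ↦ exp(−½‖Δ(Hminμ + ιν)‖²)` is EVEN by 5, so the normalised mean of `Hminμ + ιν` is `Hminμ` — i.e. (3.164) is
   the operator of (3.163).  Integrability of the Gaussian weight and of `w·ν` enter as hypotheses (standard; not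
   re-proved here), and `dλ δ(Q′λ − μ)` is read, as in B5 (1.27) / B6 (2.97), as the Haar measure of the affine slice.
Second engine: `b2b-balaban-adv1/engines-g10/h163_check.py` (exact rationals, 60 random instances, all identities
exact).  Elementary; [folklore] (Lagrange multipliers, Gaussian means). -/

namespace Literature.MathematicalPhysics.QuantumFieldTheory.Balaban1983to89.B9H163

open Matrix

variable {n m : Type*} [Fintype n] [Fintype m] [DecidableEq n] [DecidableEq m]

noncomputable section

section Algebra

variable (Δ : Matrix n n ℝ) (Q : Matrix m n ℝ) (a : ℝ)

/-- `Δ′_a = Δ + Q′*aQ′` (B9 (3.24), scalar `a`). [folklore] -/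
def Δ' : Matrix n n ℝ := Δ + a • (Qᵀ * Q)

/-- `G′ = (Δ′_a)⁻¹`. [folklore] -/
def G' : Matrix n n ℝ := (Δ' Δ Q a)⁻¹

/-- `G = Δ⁻¹`. [folklore] -/
def G : Matrix n n ℝ := Δ⁻¹

/-- `M′ = Q′G′²Q′*`. [folklore] -/
def M' : Matrix m m ℝ := Q * G' Δ Q a * G' Δ Q a * Qᵀ

/-- `M = Q′Δ⁻²Q′*`. [folklore] -/
def M : Matrix m m ℝ := Q * G Δ * G Δ * Qᵀ

/-- `R = I − G′Q′*(Q′G′²Q′*)⁻¹Q′G′` (B9 (3.25)). [folklore] [cite: Balaban1985BackgroundPropagators, (3.25) p.394] -/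
def R : Matrix n n ℝ := 1 - G' Δ Q a * Qᵀ * (M' Δ Q a)⁻¹ * Q * G' Δ Q a

/-- The operator of (3.163): `G′²Q′*(Q′G′²Q′*)⁻¹(I − aQ′G′Q′*) + aG′Q′*`. [folklore] [cite: Balaban1985BackgroundPropagators, (3.162)–(3.164) p.429] -/
def H163 : Matrix n m ℝ :=
  G' Δ Q a * G' Δ Q a * Qᵀ * (M' Δ Q a)⁻¹ * (1 - a • (Q * G' Δ Q a * Qᵀ)) + a • (G' Δ Q a * Qᵀ)

/-- The constrained-minimiser operator `Δ⁻²Q′*(Q′Δ⁻²Q′*)⁻¹` (Lagrange solution of `min ‖Δλ‖²` on `Q′λ = μ`). [folklore] -/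
def Hmin : Matrix n m ℝ := G Δ * G Δ * Qᵀ * (M Δ Q)⁻¹

variable {Δ Q a}

section Inverses

variable (hΔ : IsUnit Δ) (hΔ' : IsUnit (Δ' Δ Q a))

include hΔ in
/-- `Δ⁻¹Δ = 1`. [folklore] -/
theorem G_mul_Δ : G Δ * Δ = 1 := by
  unfold G; exact Matrix.nonsing_inv_mul _ ((Matrix.isUnit_iff_isUnit_det _).1 hΔ)

include hΔ in
/-- `ΔΔ⁻¹ = 1`. [folklore] -/
theorem Δ_mul_G : Δ * G Δ = 1 := by
  unfold G; exact Matrix.mul_nonsing_inv _ ((Matrix.isUnit_iff_isUnit_det _).1 hΔ)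

omit [DecidableEq m] in
include hΔ' in
/-- `G′Δ′ = 1`. [folklore] -/
theorem G'_mul_Δ' : G' Δ Q a * Δ' Δ Q a = 1 := by
  unfold G'; exact Matrix.nonsing_inv_mul _ ((Matrix.isUnit_iff_isUnit_det _).1 hΔ')

omit [DecidableEq m] in
include hΔ' in
/-- `Δ′G′ = 1`. [folklore] -/
theorem Δ'_mul_G' : Δ' Δ Q a * G' Δ Q a = 1 := by
  unfold G'; exact Matrix.mul_nonsing_inv _ ((Matrix.isUnit_iff_isUnit_det _).1 hΔ')

omit [DecidableEq m] in
include hΔ' in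
/-- `Δ·G′·Y = Y − aQ′*Q′G′Y` (since `Δ = Δ′ − aQ′*Q′`). [folklore] -/
theorem Δ_mul_G'_mul {p : Type*} [Fintype p] (Y : Matrix n p ℝ) :
    Δ * (G' Δ Q a * Y) = Y - a • (Qᵀ * (Q * (G' Δ Q a * Y))) := by
  have h := Δ'_mul_G' hΔ'
  unfold Δ' at h
  rw [Matrix.add_mul, Matrix.smul_mul] at h
  have h2 : Δ * G' Δ Q a = 1 - a • (Qᵀ * Q * G' Δ Q a) := by rw [← h]; abel
  rw [← Matrix.mul_assoc, h2, Matrix.sub_mul, Matrix.one_mul, Matrix.smul_mul]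
  simp only [Matrix.mul_assoc]

include hΔ in
/-- `Δ·G·Y = Y`. [folklore] -/
theorem Δ_mul_G_mul {p : Type*} [Fintype p] (Y : Matrix n p ℝ) : Δ * (G Δ * Y) = Y := by
  rw [← Matrix.mul_assoc, Δ_mul_G hΔ, Matrix.one_mul]

include hΔ hΔ' in
/-- RANGE TRANSFER: `Δ⁻¹Q′* = G′Q′*(1 + aQ′Δ⁻¹Q′*)`, i.e. `Δ⁻¹ Ran Q′* ⊆ G′ Ran Q′*` explicitly. [folklore] -/
theorem range_transfer : G Δ * Qᵀ = G' Δ Q a * (Qᵀ * (1 + a • (Q * (G Δ * Qᵀ)))) := by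
  have h1 : Δ' Δ Q a * (G Δ * Qᵀ) = Qᵀ * (1 + a • (Q * (G Δ * Qᵀ))) := by
    unfold Δ'
    rw [Matrix.add_mul, Matrix.mul_add, Matrix.mul_one, Δ_mul_G_mul hΔ, Matrix.smul_mul, Matrix.mul_smul]
    simp only [Matrix.mul_assoc]
  calc G Δ * Qᵀ = (G' Δ Q a * Δ' Δ Q a) * (G Δ * Qᵀ) := by rw [G'_mul_Δ' hΔ', Matrix.one_mul]
    _ = G' Δ Q a * (Δ' Δ Q a * (G Δ * Qᵀ)) := by rw [Matrix.mul_assoc]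
    _ = _ := by rw [h1]

end Inverses

section Conditions

variable (hΔ : IsUnit Δ) (hΔ' : IsUnit (Δ' Δ Q a)) (hM' : IsUnit (M' Δ Q a)) (hM : IsUnit (M Δ Q))

include hM' in
/-- `Q′G′²Q′*·M′⁻¹·Y = Y`. [folklore] -/
theorem QG'G'Qt_Minv_mul {p : Type*} [Fintype p] (Y : Matrix m p ℝ) :
    Q * (G' Δ Q a * (G' Δ Q a * (Qᵀ * ((M' Δ Q a)⁻¹ * Y)))) = Y := by
  calc Q * (G' Δ Q a * (G' Δ Q a * (Qᵀ * ((M' Δ Q a)⁻¹ * Y))))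
      = (M' Δ Q a * (M' Δ Q a)⁻¹) * Y := by unfold M'; simp only [Matrix.mul_assoc]
    _ = Y := by rw [Matrix.mul_nonsing_inv _ ((Matrix.isUnit_iff_isUnit_det _).1 hM'), Matrix.one_mul]

include hM' in
/-- `M′⁻¹·Q′G′²Q′*·Y = Y`. [folklore] -/
theorem Minv_QG'G'Qt_mul {p : Type*} [Fintype p] (Y : Matrix m p ℝ) :
    (M' Δ Q a)⁻¹ * (Q * (G' Δ Q a * (G' Δ Q a * (Qᵀ * Y)))) = Y := by
  calc (M' Δ Q a)⁻¹ * (Q * (G' Δ Q a * (G' Δ Q a * (Qᵀ * Y))))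
      = ((M' Δ Q a)⁻¹ * M' Δ Q a) * Y := by unfold M'; simp only [Matrix.mul_assoc]
    _ = Y := by rw [Matrix.nonsing_inv_mul _ ((Matrix.isUnit_iff_isUnit_det _).1 hM'), Matrix.one_mul]

include hM in
/-- `Q′Δ⁻²Q′*·M⁻¹·Y = Y`. [folklore] -/
theorem QGGQt_Minv_mul {p : Type*} [Fintype p] (Y : Matrix m p ℝ) :
    Q * (G Δ * (G Δ * (Qᵀ * ((M Δ Q)⁻¹ * Y)))) = Y := by
  calc Q * (G Δ * (G Δ * (Qᵀ * ((M Δ Q)⁻¹ * Y))))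
      = (M Δ Q * (M Δ Q)⁻¹) * Y := by unfold M; simp only [Matrix.mul_assoc]
    _ = Y := by rw [Matrix.mul_nonsing_inv _ ((Matrix.isUnit_iff_isUnit_det _).1 hM), Matrix.one_mul]

include hM' in
/-- `Q′·H163 = 1`: the (3.163) operator satisfies `Q′λ₀ = μ`. [folklore] [cite: Balaban1985BackgroundPropagators, (3.162)–(3.164) p.429] -/
theorem Q_mul_H163 : Q * H163 Δ Q a = 1 := by
  unfold H163
  rw [Matrix.mul_add, Matrix.mul_smul]
  simp only [Matrix.mul_assoc]
  rw [QG'G'Qt_Minv_mul hM']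
  abel

include hM in
/-- `Q′·Hmin = 1`. [folklore] -/
theorem Q_mul_Hmin : Q * Hmin Δ Q = 1 := by
  unfold Hmin
  simp only [Matrix.mul_assoc]
  rw [← Matrix.mul_one (M Δ Q)⁻¹, QGGQt_Minv_mul hM]

include hΔ' hM' in
/-- `Δ·H163 = G′Q′*M′⁻¹(1 − aQ′G′Q′*)` — the (3.162) form of (3.163). [folklore] -/
theorem Δ_mul_H163 :
    Δ * H163 Δ Q a = G' Δ Q a * (Qᵀ * ((M' Δ Q a)⁻¹ * (1 - a • (Q * (G' Δ Q a * Qᵀ))))) := by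
  unfold H163
  simp only [Matrix.mul_assoc]
  rw [Matrix.mul_add, Matrix.mul_smul, Δ_mul_G'_mul hΔ', Δ_mul_G'_mul hΔ', QG'G'Qt_Minv_mul hM']
  simp only [Matrix.mul_sub, Matrix.mul_one, Matrix.mul_smul, smul_sub, smul_smul]
  abel

include hM' in
/-- `R` annihilates `G′Q′*Y` for every `Y` (`R` kills `G′ Ran Q′*`). [folklore] -/
theorem R_mul_G'Qt {p : Type*} [Fintype p] (Y : Matrix m p ℝ) :
    R Δ Q a * (G' Δ Q a * (Qᵀ * Y)) = 0 := by
  unfold R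
  rw [Matrix.sub_mul, Matrix.one_mul, sub_eq_zero]
  simp only [Matrix.mul_assoc]
  rw [Minv_QG'G'Qt_mul hM']

include hΔ' hM' in
/-- (3.162) holds for (3.163): `R·Δ·H163 = 0`. [folklore] [cite: Balaban1985BackgroundPropagators, (3.162)–(3.164) p.429] -/
theorem R_mul_Δ_mul_H163 : R Δ Q a * (Δ * H163 Δ Q a) = 0 := by
  rw [Δ_mul_H163 hΔ' hM']
  exact R_mul_G'Qt hM' ((M' Δ Q a)⁻¹ * (1 - a • (Q * (G' Δ Q a * Qᵀ))))

include hΔ hΔ' hM' in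
/-- `R·Δ·Hmin = 0` (through `range_transfer`). [folklore] -/
theorem R_mul_Δ_mul_Hmin : R Δ Q a * (Δ * Hmin Δ Q) = 0 := by
  have h : Δ * Hmin Δ Q = G Δ * Qᵀ * (M Δ Q)⁻¹ := by
    unfold Hmin
    simp only [Matrix.mul_assoc]
    rw [Δ_mul_G_mul hΔ]
  rw [h, range_transfer hΔ hΔ']
  simp only [Matrix.mul_assoc]
  exact R_mul_G'Qt hM' ((1 + a • (Q * (G Δ * Qᵀ))) * (M Δ Q)⁻¹)

end Conditions

section Uniqueness

variable (hΔsymm : Δ.IsSymm) (hΔ : IsUnit Δ) (hΔ' : IsUnit (Δ' Δ Q a)) (hM' : IsUnit (M' Δ Q a))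

omit [Fintype n] [DecidableEq n] [DecidableEq m] in
include hΔsymm in
/-- `Δ′` is symmetric when `Δ` is. [folklore] -/
theorem Δ'_isSymm : (Δ' Δ Q a).IsSymm := by
  unfold Δ'
  rw [Matrix.IsSymm, Matrix.transpose_add, Matrix.transpose_smul, Matrix.transpose_mul,
    Matrix.transpose_transpose, hΔsymm.eq]

omit [DecidableEq m] in
include hΔsymm in
/-- `G′` is symmetric when `Δ` is. [folklore] -/
theorem G'_isSymm : (G' Δ Q a).IsSymm := by
  unfold G'
  rw [Matrix.IsSymm, Matrix.transpose_nonsing_inv, (Δ'_isSymm hΔsymm).eq]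

omit [Fintype m] [DecidableEq m] in
include hΔsymm in
/-- `Δ⁻¹` is symmetric when `Δ` is. [folklore] -/
theorem G_isSymm : (G Δ).IsSymm := by
  unfold G
  rw [Matrix.IsSymm, Matrix.transpose_nonsing_inv, hΔsymm.eq]

omit [DecidableEq n] [DecidableEq m] in
/-- `Δλ = Δ′λ − aQ′*Q′λ`. [folklore] -/
theorem Δ_mulVec (lam : n → ℝ) : Δ *ᵥ lam = Δ' Δ Q a *ᵥ lam - a • (Qᵀ *ᵥ (Q *ᵥ lam)) := by
  unfold Δ'
  rw [Matrix.add_mulVec, Matrix.smul_mulVec, Matrix.mulVec_mulVec]; abel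

include hΔsymm hΔ hΔ' in
/-- UNIQUENESS (needs only Δ symmetric invertible and Δ′ invertible — not M′; p. 429 "Thus the configuration λ₀ is determined uniquely by the two conditions"):
`Q′λ = 0` and `RΔλ = 0` force `λ = 0`. [folklore] -/
theorem unique_of_conditions (lam : n → ℝ) (hQ : Q *ᵥ lam = 0)
    (hR : R Δ Q a *ᵥ (Δ *ᵥ lam) = 0) : lam = 0 := by
  -- From RΔλ = 0: Δλ = G′Q′*σ with σ := M′⁻¹Q′G′Δλ.
  obtain ⟨σ, hσ⟩ : ∃ σ : m → ℝ, σ = (M' Δ Q a)⁻¹ *ᵥ (Q *ᵥ (G' Δ Q a *ᵥ (Δ *ᵥ lam))) := ⟨_, rfl⟩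
  have h1 : Δ *ᵥ lam = G' Δ Q a *ᵥ (Qᵀ *ᵥ σ) := by
    unfold R at hR
    rw [Matrix.sub_mulVec, Matrix.one_mulVec, sub_eq_zero] at hR
    rw [hσ]
    simpa only [Matrix.mulVec_mulVec, Matrix.mul_assoc] using hR
  -- G′Δλ = λ − aG′Q′*Q′λ = λ.
  have h2 : G' Δ Q a *ᵥ (Δ *ᵥ lam) = lam := by
    rw [Δ_mulVec (Q := Q) (a := a) lam, hQ, Matrix.mulVec_zero, smul_zero, sub_zero, Matrix.mulVec_mulVec,
      G'_mul_Δ' hΔ', Matrix.one_mulVec]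
  -- ⟨Δλ, Δλ⟩ = ⟨Δλ, G′Q′*σ⟩ = ⟨G′Δλ, Q′*σ⟩ = ⟨Q′λ, σ⟩ = 0.
  have h3 : (Δ *ᵥ lam) ⬝ᵥ (Δ *ᵥ lam) = 0 := by
    calc (Δ *ᵥ lam) ⬝ᵥ (Δ *ᵥ lam) = (Δ *ᵥ lam) ⬝ᵥ (G' Δ Q a *ᵥ (Qᵀ *ᵥ σ)) := by rw [← h1]
      _ = (G' Δ Q a *ᵥ (Δ *ᵥ lam)) ⬝ᵥ (Qᵀ *ᵥ σ) := B9SectEKernel.dot_mulVec_symm (G'_isSymm hΔsymm) _ _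
      _ = lam ⬝ᵥ (Qᵀ *ᵥ σ) := by rw [h2]
      _ = (Q *ᵥ lam) ⬝ᵥ σ := B9SectEKernel.dot_transpose_mulVec Q lam σ
      _ = 0 := by rw [hQ, zero_dotProduct]
  have h4 : Δ *ᵥ lam = 0 := dotProduct_self_eq_zero.1 h3
  calc lam = (G Δ * Δ) *ᵥ lam := by rw [G_mul_Δ hΔ, Matrix.one_mulVec]
    _ = G Δ *ᵥ (Δ *ᵥ lam) := by rw [Matrix.mulVec_mulVec]
    _ = 0 := by rw [h4, Matrix.mulVec_zero]

omit [Fintype n] [DecidableEq n] in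
/-- `(P e_j)_i = P_{ij}`. [folklore] -/
theorem mulVec_single_one_apply' (P : Matrix n m ℝ) (i : n) (j : m) :
    (P *ᵥ Pi.single j 1) i = P i j := by
  rw [Matrix.mulVec_single_one]; rfl

include hΔsymm hΔ hΔ' hM' in
/-- MAIN IDENTITY: the operator of (3.163) is the constrained-minimiser operator `Hmin` — for EVERY `a`
(the printed "easy to verify": (3.163) = (3.164), see `h164_mean` for the Gaussian side). [folklore]
[cite: Balaban1985BackgroundPropagators, (3.162)–(3.164) p.429] -/
theorem H163_eq_Hmin (hM : IsUnit (M Δ Q)) : H163 Δ Q a = Hmin Δ Q := by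
  have eQ : Q * (H163 Δ Q a - Hmin Δ Q) = 0 := by
    rw [Matrix.mul_sub, Q_mul_H163 hM', Q_mul_Hmin hM, sub_self]
  have eR : R Δ Q a * (Δ * (H163 Δ Q a - Hmin Δ Q)) = 0 := by
    rw [Matrix.mul_sub, Matrix.mul_sub, R_mul_Δ_mul_H163 hΔ' hM', R_mul_Δ_mul_Hmin hΔ hΔ' hM', sub_self]
  have key : ∀ μ : m → ℝ, (H163 Δ Q a - Hmin Δ Q) *ᵥ μ = 0 := by
    intro μ
    apply unique_of_conditions hΔsymm hΔ hΔ'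
    · rw [Matrix.mulVec_mulVec, eQ, Matrix.zero_mulVec]
    · rw [Matrix.mulVec_mulVec, Matrix.mulVec_mulVec, Matrix.mul_assoc, eR, Matrix.zero_mulVec]
  rw [← sub_eq_zero]
  ext i j
  have := congrFun (key (Pi.single j 1)) i
  rwa [mulVec_single_one_apply'] at this

end Uniqueness

section Minimiser

variable (hΔsymm : Δ.IsSymm) (hΔ : IsUnit Δ)

include hΔsymm hΔ in
/-- ORTHOGONALITY: `⟨ΔHminμ, Δν⟩ = 0` whenever `Q′ν = 0` (the first-order condition of the constrained minimum). [folklore] -/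
theorem orth_ker (μ : m → ℝ) (ν : n → ℝ) (hν : Q *ᵥ ν = 0) :
    (Δ *ᵥ (Hmin Δ Q *ᵥ μ)) ⬝ᵥ (Δ *ᵥ ν) = 0 := by
  have h : Δ *ᵥ (Hmin Δ Q *ᵥ μ) = G Δ *ᵥ (Qᵀ *ᵥ ((M Δ Q)⁻¹ *ᵥ μ)) := by
    unfold Hmin
    simp only [Matrix.mulVec_mulVec, Matrix.mul_assoc]
    rw [Δ_mul_G_mul hΔ]
  rw [h, ← B9SectEKernel.dot_mulVec_symm (G_isSymm hΔsymm), Matrix.mulVec_mulVec ν (G Δ) Δ, G_mul_Δ hΔ, Matrix.one_mulVec,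
    dotProduct_comm, B9SectEKernel.dot_transpose_mulVec, hν, zero_dotProduct]

include hΔsymm hΔ in
/-- PYTHAGORAS on the slice: `‖Δ(Hminμ + ν)‖² = ‖ΔHminμ‖² + ‖Δν‖²` for `Q′ν = 0`; in particular `Hminμ` minimises
`‖Δλ‖²` over `{λ : Q′λ = μ}` (every such `λ` is `Hminμ + ν` with `Q′ν = 0` when `Q′Hmin = 1`). [folklore] -/
theorem isMinimiser (μ : m → ℝ) (ν : n → ℝ) (hν : Q *ᵥ ν = 0) :
    (Δ *ᵥ (Hmin Δ Q *ᵥ μ + ν)) ⬝ᵥ (Δ *ᵥ (Hmin Δ Q *ᵥ μ + ν))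
      = (Δ *ᵥ (Hmin Δ Q *ᵥ μ)) ⬝ᵥ (Δ *ᵥ (Hmin Δ Q *ᵥ μ)) + (Δ *ᵥ ν) ⬝ᵥ (Δ *ᵥ ν) := by
  have h0 := orth_ker hΔsymm hΔ μ ν hν
  have h0' : (Δ *ᵥ ν) ⬝ᵥ (Δ *ᵥ (Hmin Δ Q *ᵥ μ)) = 0 := by rw [dotProduct_comm]; exact h0
  rw [Matrix.mulVec_add, add_dotProduct, dotProduct_add, dotProduct_add, h0, h0']
  ring

end Minimiser

end Algebra

section GaussianMean

open MeasureTheory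

variable {E : Type*} [NormedAddCommGroup E] [NormedSpace ℝ E] [CompleteSpace E] [MeasurableSpace E]
  [BorelSpace E] (μ : Measure E) [μ.IsNegInvariant]

omit [CompleteSpace E] in
/-- For an even integrable weight, `∫ w(ν)·ν = 0` (neg-invariance of the measure). [folklore] -/
theorem integral_smul_even_eq_zero (w : E → ℝ) (hw : ∀ ν, w (-ν) = w ν) :
    ∫ ν, w ν • ν ∂μ = 0 := by
  have h := integral_neg_eq_self (fun ν => w ν • ν) μ
  have h' : (fun ν => w (-ν) • (-ν)) = fun ν => -(w ν • ν) := by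
    funext ν; rw [hw ν, smul_neg]
  rw [h', integral_neg, neg_eq_iff_add_eq_zero, ← two_smul ℝ] at h
  exact (smul_eq_zero.1 h).resolve_left two_ne_zero

/-- The mean of `x + ν` against an even weight is `x` (times the mass). [folklore] -/
theorem mean_even_eq (w : E → ℝ) (hw : ∀ ν, w (-ν) = w ν) (x : E)
    (hw1 : Integrable w μ) (hint : Integrable (fun ν => w ν • ν) μ) :
    ∫ ν, w ν • (x + ν) ∂μ = (∫ ν, w ν ∂μ) • x := by
  have h1 : (fun ν => w ν • (x + ν)) = fun ν => w ν • x + w ν • ν := by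
    funext ν; rw [smul_add]
  rw [h1, integral_add (hw1.smul_const x) hint, integral_smul_const,
    integral_smul_even_eq_zero μ w hw, add_zero]

/-- (3.164): with `ι : E → (n → ℝ)` the (linear) parametrisation of the slice direction `N(Q′)` (`Q′ι = 0`), the
Gaussian weight `w(ν) = exp(−½‖Δ(Hminμ + ιν)‖²)` is even in `ν`, so the normalised mean of `λ = Hminμ + ιν`
is `Hminμ` — i.e. `H′μ` of (3.164) is the operator `Hmin` = (3.163) (`H163_eq_Hmin`). [folklore] -/
theorem h164_mean [FiniteDimensional ℝ E] (Δ : Matrix n n ℝ) (Q : Matrix m n ℝ) (hΔsymm : Δ.IsSymm)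
    (hΔ : IsUnit Δ) (ι : E →ₗ[ℝ] (n → ℝ)) (hι : ∀ ν, Q *ᵥ ι ν = 0) (μ₀ : m → ℝ)
    (hw1 : Integrable (fun ν : E =>
      Real.exp (-(1/2 : ℝ) * ((Δ *ᵥ (Hmin Δ Q *ᵥ μ₀ + ι ν)) ⬝ᵥ (Δ *ᵥ (Hmin Δ Q *ᵥ μ₀ + ι ν))))) μ)
    (hint : Integrable (fun ν : E =>
      Real.exp (-(1/2 : ℝ) * ((Δ *ᵥ (Hmin Δ Q *ᵥ μ₀ + ι ν)) ⬝ᵥ (Δ *ᵥ (Hmin Δ Q *ᵥ μ₀ + ι ν)))) • ν) μ)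
    (hZ : ∫ ν : E, Real.exp (-(1/2 : ℝ) * ((Δ *ᵥ (Hmin Δ Q *ᵥ μ₀ + ι ν)) ⬝ᵥ (Δ *ᵥ (Hmin Δ Q *ᵥ μ₀ + ι ν)))) ∂μ ≠ 0) :
    (∫ ν : E, Real.exp (-(1/2 : ℝ) * ((Δ *ᵥ (Hmin Δ Q *ᵥ μ₀ + ι ν)) ⬝ᵥ (Δ *ᵥ (Hmin Δ Q *ᵥ μ₀ + ι ν)))) ∂μ)⁻¹
      • ∫ ν : E, Real.exp (-(1/2 : ℝ) * ((Δ *ᵥ (Hmin Δ Q *ᵥ μ₀ + ι ν)) ⬝ᵥ (Δ *ᵥ (Hmin Δ Q *ᵥ μ₀ + ι ν))))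
          • (Hmin Δ Q *ᵥ μ₀ + ι ν) ∂μ
      = Hmin Δ Q *ᵥ μ₀ := by
  set w : E → ℝ := fun ν =>
    Real.exp (-(1/2 : ℝ) * ((Δ *ᵥ (Hmin Δ Q *ᵥ μ₀ + ι ν)) ⬝ᵥ (Δ *ᵥ (Hmin Δ Q *ᵥ μ₀ + ι ν)))) with hwdef
  -- evenness from Pythagoras on the slice
  have hw : ∀ ν, w (-ν) = w ν := by
    intro ν
    simp only [hwdef, map_neg]
    rw [isMinimiser hΔsymm hΔ μ₀ (ι ν) (hι ν), isMinimiser hΔsymm hΔ μ₀ (-ι ν)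
      (by rw [Matrix.mulVec_neg, hι ν, neg_zero]), Matrix.mulVec_neg, neg_dotProduct, dotProduct_neg,
      neg_neg]
  -- the mean of `x + ιν` against an even weight: the `ιν` part integrates to zero
  set L : E →L[ℝ] (n → ℝ) := LinearMap.toContinuousLinearMap ι with hLdef
  have hL : ∀ v, ι v = L v := fun v => rfl
  have hlin : (fun ν : E => w ν • (Hmin Δ Q *ᵥ μ₀ + ι ν))
      = fun ν => w ν • (Hmin Δ Q *ᵥ μ₀) + L (w ν • ν) := by
    funext ν; rw [smul_add, map_smul, hL]
  have hint' : Integrable (fun ν : E => L (w ν • ν)) μ := L.integrable_comp hint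
  rw [hlin, integral_add (hw1.smul_const _) hint', integral_smul_const,
    ContinuousLinearMap.integral_comp_comm L hint, integral_smul_even_eq_zero μ w hw, map_zero, add_zero,
    smul_smul, inv_mul_cancel₀ hZ, one_smul]

end GaussianMean

end

end Literature.MathematicalPhysics.QuantumFieldTheory.Balaban1983to89.B9H163
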